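import Literature.Probability.LatticeModels.RandomCurrents
import Mathlib.Combinatorics.SimpleGraph.Trails
import Mathlib.Analysis.Complex.Exponential
import Mathlib.Analysis.SpecialFunctions.Exponential
import HarnessLib

/-!
# The random-current representation of the Ising model: proofs

Sibling proof file of `Literature.Probability.LatticeModels.RandomCurrents` (which, containing the
definitions `Current`, `currentSum`, `pairWeight`, `doubleCurrentMeasure`, …, is review-gated and
states its results as named facts). This file **discharges** eight of those named facts, with
the proofs of Griffiths–Hurst–Sherman 1970 / Aizenman 1982 as presented in

* H. Duminil-Copin, *Random currents expansion of the Ising model*, arXiv:1607.06933 (2016), §2.1,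
  derivation of eq. (2.2) ("expand `e^{βσ_xσ_y}` … the sum over `σ` factorises over the vertices
  and vanishes unless every vertex has even degree in `n + 1_A`"), and §2.2 (pairs of currents):

* `summable_currentWeight_holds`, `summable_currentWeight_indicator_holds` — `∑_n |w_β(n)| ≤
  (e^{|β|})^{|E|}` (bounded partial sums over the boxes `{n | n_e < N}`, which are products of
  partial exponential sums, `Real.sum_le_exp_of_nonneg`);
* `currentSum_empty_pos_holds` — the zero current contributes `1`;
* `isingPartitionFunction_free_eq_holds` — `Z^∅_{G;β,0} = 2^{|V|} ∑_{∂n=∅} w_β(n)`;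
* `isingCorr_free_eq_currentSum_div_holds`, `isingTwoPoint_free_eq_currentSum_div_holds` — the
  random-current representation **(2.2)** `⟨σ_A⟩^∅_{G;β,0} = ∑_{∂n=A} w_β(n) / ∑_{∂n=∅} w_β(n)`;
* `hasSum_pairWeight_holds'` (`hasSum_pairWeight`), `isProbabilityMeasure_doubleCurrentMeasure_holds`;
* **the switching lemma** `currentSum_switching_holds` (Griffiths–Hurst–Sherman 1970; Aizenman 1982,
  Lemma 3.2; Duminil-Copin 2016, **Lemma 2.2**, two-source form, every real `β`, bounded `F`) and its
  corollaries `currentSum_mul_currentSum_pair_holds` (probabilistic form, `β ≥ 0`) and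
  `isingTwoPoint_free_sq_eq_holds` (`⟨σ_xσ_y⟩² = P^∅⊗P^∅[x ↔ y]`, Aizenman 1982, Prop. 3.1;
  Duminil-Copin 2016, Cor. 2.3) — so that **all eleven named facts of `RandomCurrents.lean` are
  discharged**.

## Method

For each configuration `σ`, the box partial sums `∑_{n : n_e < N} w_β(n) ∏_e (σ_xσ_y)^{n_e}` equal
`∏_e ∑_{k<N} (βσ_xσ_y)^k/k!` (`Current.sum_piFinset_weight_mul`, `Finset.prod_univ_sum`) and tend
to `∏_e e^{βσ_xσ_y} = e^{-βH(σ)}` (`tendsto_sum_piFinset_weight_mul_prod`); summing over `σ` first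
instead, `∑_σ σ_A ∏_e (σ_xσ_y)^{n_e} = ∏_x ∑_{u=±1} u^{1_A(x)+deg_n(x)} = 2^{|V|} 1{∂n = A}`
(`sum_spinProduct_mul_prod_bondSpin_pow`), and the box partial sums of the summable family
`1{∂n=A} w_β(n)` tend to its `tsum` (`tendsto_sum_piFinset_of_summable`, the boxes being cofinal,
`tendsto_piFinset_range_atTop`); uniqueness of limits gives
`∑_σ σ_A e^{-βH(σ)} = 2^{|V|} currentSum β A` (`sum_isingWeight_mul_spinProduct_eq`), valid for
**every real `β`** (as the named facts demand). The finite-sum formula `integral_isingMeasure` and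
the equivalence `(↥univ → ℤˣ) ≃ (V → ℤˣ)` translate to the tree's `isingCorr G univ β 0 .free`.

The switching lemma follows the printed proof (Duminil-Copin 2016, proof of Lemma 2.2) literally:
(i) change of variables `(𝐦, 𝐧) = (𝐧₁+𝐧₂, 𝐧₁)` on absolutely convergent double series
(`tsum_pair_eq_tsum_sum_box`: the map is injective with image `{𝐧 ≤ 𝐦}`, inner sums finite;
`Function.Injective.tsum_eq`, `Summable.tsum_prod'`); (ii) `w(𝐧)w(𝐦-𝐧) = w(𝐦)C(𝐦,𝐧)`
(`Current.weight_mul_weight_tsub`); (iii) for fixed `𝐦` the identity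
`∑_{𝐧≤𝐦, ∂𝐧=A, ∂(𝐦-𝐧)=B} C(𝐦,𝐧) = 1{x↔y in 𝐦̂} ∑_{𝐧≤𝐦, ∂𝐧=A∆B, ∂(𝐦-𝐧)=∅} C(𝐦,𝐧)`, `B = {x}∆{y}`
(`Current.switching_comb`): the binomial multiplicities count **labelled** sub-currents
`T e ⊆ Fin (m e)` (`Current.sum_labelled_eq_sum_binom`, `Fintype.card_piFinset`,
`Finset.card_powersetCard`); if `x ↔ y` in `𝐦̂`, one copy of each edge of a simple path from `x` to
`y` is a labelled sub-current `𝓚` with `∂𝓚 = {x,y}` (`Current.exists_labelled_sources_pair`, via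
`SimpleGraph.Walk.IsTrail.even_countP_edges_iff`), and `𝓝 ↦ 𝓝 ∆ 𝓚` is an involution exchanging the
constraints `∂ = A` and `∂ = A ∆ {x,y}` (`Current.sources_symmDiff`,
`Current.card_filter_sources_eq_of_symmDiff`); if not, no term survives on the left, because in the
trace of any current a source is connected to another source (`Current.exists_source_reachable`, the
degree sum over a connected component being even) — here with `∂(𝐦-𝐧) = {x,y}`; the cases
`∂𝐦 ≠ A ∆ B` (both sides vanish, `Current.sources_tsub`) and `x = y` (both sides coincide) are
immediate.

## Mathlib status

No random currents in Mathlib. Anchors: `Fintype.piFinset`, `Finset.prod_univ_sum`,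
`Real.sum_le_exp_of_nonneg`, `summable_of_sum_le`, `Summable.of_norm_bounded`,
`Filter.tendsto_atTop_finset_of_monotone`, `HasSum.comp`, `HasSum.tendsto_sum_nat`,
`NormedSpace.expSeries_div_hasSum_exp`, `tendsto_finsetProd`, `tendsto_finsetSum`,
`tendsto_nhds_unique`, `Fintype.prod_sum`, `Finset.prod_comm`, `summable_mul_of_summable_norm`,
`HasSum.mul`, `Measure.sum_apply`, `ENNReal.ofReal_tsum_of_nonneg`, `Equiv.subtypeUnivEquiv`;
switching: `Finset.sum_fiberwise_of_maps_to`, `Fintype.card_piFinset`, `Finset.card_powersetCard`,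
`Finset.card_bij`, `symmDiff_left_injective`, `SimpleGraph.Reachable.elim_path`,
`SimpleGraph.Walk.IsTrail.even_countP_edges_iff`, `SimpleGraph.Walk.edges_subset_edgeSet`,
`SimpleGraph.edgeSet_fromEdgeSet`, `List.toFinset_card_of_nodup`, `List.countP_eq_length_filter`,
`Finset.exists_mem_ne`, `Finset.sum_nat_mod`, `Nat.odd_sub`, `Nat.choose_mul_factorial_mul_factorial`,
`Function.Injective.tsum_eq`, `Function.Injective.summable_iff`, `Summable.tsum_prod'`,
`tsum_eq_sum`, `summable_of_ne_finset_zero`, `hasSum_zero_iff_of_nonneg`, `Measure.dirac_apply'`.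
-/

noncomputable section

open MeasureTheory Finset Filter Topology
open scoped symmDiff

namespace Literature.Probability.LatticeModels

variable {V : Type*} [Fintype V] (G : SimpleGraph V) [DecidableRel G.Adj]

namespace Current

/-! ### Summability of the current weights -/

/-- `|w_β(n)| = w_{|β|}(n)`. [folklore] -/
theorem abs_weight (β : ℝ) (n : Current G) : |n.weight β| = n.weight |β| := by
  simp only [weight, Finset.abs_prod, abs_div, abs_pow, Nat.abs_cast]

/-- The unnormalised weight `∏_e β^{n_e}/n_e!` is the product of the terms of the exponential
series; summed over the currents with all values `< N` it is a product of partial sums. [folklore] -/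
theorem sum_piFinset_weight_mul [DecidableEq V] (β : ℝ) (b : G.edgeFinset → ℝ) (N : ℕ) :
    ∑ n ∈ Fintype.piFinset (fun _ : G.edgeFinset => range N),
        weight β n * ∏ e, b e ^ n e =
      ∏ e : G.edgeFinset, ∑ k ∈ range N, (β * b e) ^ k / (k.factorial : ℝ) := by
  rw [Finset.prod_univ_sum]
  refine Finset.sum_congr rfl fun n _ => ?_
  rw [weight, ← Finset.prod_mul_distrib]
  exact Finset.prod_congr rfl fun e _ => by rw [mul_pow]; ring

/-- Bounded partial sums: `∑_{n ∈ S} w_x(n) ≤ (exp x)^{|E|}` for `x ≥ 0` (`∑_{k<N} x^k/k! ≤ eˣ`). [cite: DuminilCopin2016, §2.1] -/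
theorem sum_weight_le {x : ℝ} (hx : 0 ≤ x) (S : Finset (Current G)) :
    ∑ n ∈ S, n.weight x ≤ Real.exp x ^ G.edgeFinset.card := by
  classical
  set N := S.sup (fun n => univ.sup n) + 1 with hN
  have hS : S ⊆ Fintype.piFinset fun _ : G.edgeFinset => range N := by
    intro n hn
    rw [Fintype.mem_piFinset]
    intro e
    rw [mem_range]
    have h1 : n e ≤ univ.sup n := Finset.le_sup (f := n) (mem_univ e)
    have h2 : univ.sup n ≤ S.sup (fun n => univ.sup n) :=
      Finset.le_sup (f := fun n : Current G => univ.sup n) hn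
    omega
  calc ∑ n ∈ S, n.weight x
      ≤ ∑ n ∈ Fintype.piFinset (fun _ : G.edgeFinset => range N), weight x n :=
        Finset.sum_le_sum_of_subset_of_nonneg hS fun n _ _ => weight_nonneg hx n
    _ = ∏ _e : G.edgeFinset, ∑ k ∈ range N, x ^ k / (k.factorial : ℝ) := by
        have h := sum_piFinset_weight_mul G x (fun _ => 1) N
        simp only [one_pow, Finset.prod_const_one, mul_one] at h
        exact h
    _ ≤ ∏ _e : G.edgeFinset, Real.exp x :=
        Finset.prod_le_prod (fun e _ => Finset.sum_nonneg fun k _ => by positivity)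
          fun e _ => Real.sum_le_exp_of_nonneg hx N
    _ = Real.exp x ^ G.edgeFinset.card := by
        rw [Finset.prod_const, Finset.card_univ, Fintype.card_coe]

/-- The weights `w_{|β|}` are summable over all currents. [cite: DuminilCopin2016, §2.1] -/
theorem summable_weight_abs (β : ℝ) : Summable fun n : Current G => n.weight |β| :=
  summable_of_sum_le (fun n => weight_nonneg (abs_nonneg β) n) (sum_weight_le G (abs_nonneg β))

end Current

section CurrentSum

variable [DecidableEq V]

omit [DecidableEq V] in
/-- **Discharge of `summable_currentWeight`**: `∑_n |w_β(n)| ≤ (e^{|β|})^{|E|} < ∞`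
(Duminil-Copin 2016, §2.1). [cite: DuminilCopin2016, §2.1] -/
theorem summable_currentWeight_holds : summable_currentWeight G := fun β =>
  (Current.summable_weight_abs G β).of_norm_bounded fun n => by
    rw [Real.norm_eq_abs, Current.abs_weight]

/-- **Discharge of `summable_currentWeight_indicator`** (Duminil-Copin 2016, §2.1). [cite: DuminilCopin2016, §2.1] -/
theorem summable_currentWeight_indicator_holds : summable_currentWeight_indicator G := fun β A =>
  (Current.summable_weight_abs G β).of_norm_bounded fun n => by
    split_ifs
    · rw [Real.norm_eq_abs, Current.abs_weight]
    · rw [norm_zero]; exact Current.weight_nonneg (abs_nonneg β) n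

/-- **Discharge of `currentSum_empty_pos`**: the zero current contributes `1` and all terms are
nonnegative for `β ≥ 0` (Duminil-Copin 2016, §2.1). [cite: DuminilCopin2016, §2.1] -/
theorem currentSum_empty_pos_holds : currentSum_empty_pos G := by
  intro β hβ
  refine (summable_currentWeight_indicator_holds G β ∅).tsum_pos (fun n => ?_) 0 (by simp)
  split_ifs
  · exact Current.weight_nonneg hβ n
  · exact le_rfl

/-! ### Partial sums over boxes of currents converge to the `tsum` -/

/-- The boxes `{n | n_e < N ∀ e}` exhaust the currents. [folklore] -/
theorem tendsto_piFinset_range_atTop :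
    Tendsto (fun N : ℕ => Fintype.piFinset fun _ : G.edgeFinset => range N) atTop atTop := by
  classical
  refine Filter.tendsto_atTop_finset_of_monotone (fun N M hNM => ?_) fun n => ?_
  · exact Fintype.piFinset_subset _ _ fun _ => range_subset_range.2 hNM
  · refine ⟨univ.sup n + 1, Fintype.mem_piFinset.2 fun e => mem_range.2 ?_⟩
    have : n e ≤ univ.sup n := Finset.le_sup (f := n) (mem_univ e)
    omega

/-- For a summable family of reals indexed by currents, the sums over the boxes tend to the `tsum`. [folklore] -/
theorem tendsto_sum_piFinset_of_summable {f : Current G → ℝ} (hf : Summable f) :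
    Tendsto (fun N : ℕ => ∑ n ∈ Fintype.piFinset (fun _ : G.edgeFinset => range N), f n) atTop
      (𝓝 (∑' n, f n)) :=
  hf.hasSum.comp (tendsto_piFinset_range_atTop G)

/-! ### The expansion: `∑_σ σ_A ∏_e (σ_e)^{n_e} = 2^{|V|} 1{∂n = A}` -/

omit [DecidableRel G.Adj] in
/-- The bond variable of an edge of `G` is the product of the spins of its (two, distinct) endpoints. [folklore] -/
theorem bondSpin_eq_prod_filter (σ : SpinConfig V) (e : Sym2 V) (he : e ∈ G.edgeSet) :
    bondSpin σ e = ∏ x ∈ univ.filter (fun x => x ∈ e), spinAt x σ := by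
  revert he
  induction e using Sym2.ind with
  | _ a b =>
    intro he
    have hab : a ≠ b := G.ne_of_adj ((SimpleGraph.mem_edgeSet G).1 he)
    have hfil : univ.filter (fun x => x ∈ (s(a, b) : Sym2 V)) = {a, b} := by
      ext x
      simp only [Finset.mem_filter, Finset.mem_univ, true_and, Sym2.mem_iff, Finset.mem_insert,
        Finset.mem_singleton]
    rw [hfil, bondSpin_mk, Finset.prod_pair hab]

/-- Regrouping by vertices: `σ_A ∏_e (σ_e)^{n_e} = ∏_x σ_x^{1_A(x) + deg_n(x)}` (Duminil-Copin 2016,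
§2.1, derivation of (2.2): "the sum over `σ` factorises over vertices"). [cite: DuminilCopin2016, §2.1, eq. (2.2)] -/
theorem spinProduct_mul_prod_bondSpin_pow (A : Finset V) (n : Current G) (σ : SpinConfig V) :
    spinProduct A σ * ∏ e : G.edgeFinset, bondSpin σ (e : Sym2 V) ^ n e =
      ∏ x, spinAt x σ ^ ((if x ∈ A then 1 else 0) + n.degree x) := by
  have hA : spinProduct A σ = ∏ x, spinAt x σ ^ (if x ∈ A then 1 else 0) := by
    simp only [pow_ite, pow_one, pow_zero]
    rw [Finset.prod_ite_mem, Finset.univ_inter]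
    rfl
  have hB : ∏ e : G.edgeFinset, bondSpin σ (e : Sym2 V) ^ n e = ∏ x, spinAt x σ ^ n.degree x := by
    rw [Finset.prod_congr rfl fun (e : G.edgeFinset) _ => by
      rw [bondSpin_eq_prod_filter G σ (e : Sym2 V) (SimpleGraph.mem_edgeFinset.1 e.2), ← Finset.prod_pow,
        Finset.prod_filter]]
    rw [Finset.prod_comm]
    refine Finset.prod_congr rfl fun x _ => ?_
    rw [Current.degree, ← Finset.prod_pow_eq_pow_sum]
    refine Finset.prod_congr rfl fun e _ => ?_
    split_ifs <;> simp
  rw [hA, hB, ← Finset.prod_mul_distrib]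
  exact Finset.prod_congr rfl fun x _ => by rw [← pow_add]

/-- `∑_{u = ±1} u^m = 2` if `m` is even and `0` otherwise. [folklore] -/
theorem sum_units_pow (m : ℕ) : ∑ u : ℤˣ, (((u : ℤ) : ℝ)) ^ m = if Even m then 2 else 0 := by
  rw [UnitsInt.univ, Finset.sum_insert (by decide), Finset.sum_singleton]
  simp only [Units.val_one, Int.cast_one, one_pow, Units.val_neg, Int.cast_neg]
  rcases Nat.even_or_odd m with h | h
  · rw [h.neg_one_pow, if_pos h]; norm_num
  · rw [h.neg_one_pow, if_neg (Nat.not_even_iff_odd.2 h)]; norm_num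

/-- **The vertex sums** (Duminil-Copin 2016, §2.1, eq. (2.2)): for a current `n` and `A ⊆ V`,
`∑_σ σ_A ∏_e (σ_xσ_y)^{n_e} = 2^{|V|}` if `∂n = A` and `0` otherwise. [cite: DuminilCopin2016, §2.1, eq. (2.2)] -/
theorem sum_spinProduct_mul_prod_bondSpin_pow (A : Finset V) (n : Current G) :
    ∑ σ : SpinConfig V, spinProduct A σ * ∏ e : G.edgeFinset, bondSpin σ (e : Sym2 V) ^ n e =
      if n.sources = A then (2 : ℝ) ^ Fintype.card V else 0 := by
  simp_rw [spinProduct_mul_prod_bondSpin_pow G A n]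
  have h : ∑ σ : SpinConfig V, ∏ x, spinAt x σ ^ ((if x ∈ A then 1 else 0) + n.degree x) =
      ∏ x : V, ∑ u : ℤˣ, (((u : ℤ) : ℝ)) ^ ((if x ∈ A then 1 else 0) + n.degree x) := by
    rw [Fintype.prod_sum]
    rfl
  rw [h]
  simp_rw [sum_units_pow]
  by_cases hs : n.sources = A
  · rw [if_pos hs]
    have hall : ∀ x, Even ((if x ∈ A then 1 else 0) + n.degree x) := by
      intro x
      have hx : x ∈ A ↔ Odd (n.degree x) := by rw [← hs, Current.mem_sources_iff]
      by_cases hxA : x ∈ A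
      · rw [if_pos hxA, add_comm]; exact (hx.1 hxA).add_one
      · rw [if_neg hxA, zero_add]
        exact Nat.not_odd_iff_even.1 fun h => hxA (hx.2 h)
    rw [Finset.prod_congr rfl fun x _ => if_pos (hall x), Finset.prod_const, Finset.card_univ]
  · rw [if_neg hs]
    -- some vertex has an odd exponent
    have hex : ∃ x, ¬Even ((if x ∈ A then 1 else 0) + n.degree x) := by
      by_contra hcon
      have hall : ∀ x, Even ((if x ∈ A then 1 else 0) + n.degree x) :=
        fun x => by_contra fun hx => hcon ⟨x, hx⟩
      apply hs
      ext x
      rw [Current.mem_sources_iff]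
      have h := hall x
      by_cases hxA : x ∈ A
      · rw [if_pos hxA] at h
        simp only [hxA, iff_true]
        rcases Nat.even_or_odd (n.degree x) with h' | h'
        · exact absurd h (Nat.not_even_iff_odd.2 (by rw [add_comm]; exact h'.add_one))
        · exact h'
      · rw [if_neg hxA, zero_add] at h
        simp only [hxA, iff_false, Nat.not_odd_iff_even]
        exact h
    obtain ⟨x, hx⟩ := hex
    exact Finset.prod_eq_zero (Finset.mem_univ x) (if_neg hx)

/-! ### The free Ising model on the whole graph -/

/-- On the whole vertex set every edge is an inside edge: `ℰ_{univ} = E(G)`. [folklore] -/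
theorem edgesIn_univ : edgesIn G (univ : Finset V) = G.edgeFinset := by
  ext e
  rw [mem_edgesIn_iff, SimpleGraph.mem_edgeFinset]
  simp

/-- The free-boundary, zero-field Boltzmann weight on the whole graph as a product over edges:
`e^{-βH(σ)} = ∏_e e^{βσ_xσ_y}`. [cite: DuminilCopin2016, §2.1] -/
theorem isingWeight_univ_free_eq (β : ℝ) (τ : ↥(univ : Finset V) → ℤˣ) :
    isingWeight G univ β 0 .free τ =
      ∏ e : G.edgeFinset, Real.exp (β * bondSpin (glue univ τ .free) (e : Sym2 V)) := by
  rw [isingWeight, isingHamiltonian, interactionEdges_free, edgesIn_univ, ← Real.exp_sum]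
  congr 1
  rw [zero_mul, sub_zero, mul_neg, neg_mul, neg_neg, Finset.mul_sum, ← Finset.sum_coe_sort]

/-- The expansion of one configuration's weight over currents: the box partial sums
`∑_{n : n_e < N} w_β(n) ∏_e (σ_e)^{n_e}` tend to `∏_e e^{βσ_e}` ("expanding `e^{βσ_xσ_y}` for
each `xy`", Duminil-Copin 2016, §2.1). [cite: DuminilCopin2016, §2.1, eq. (2.2)] -/
theorem tendsto_sum_piFinset_weight_mul_prod (β : ℝ) (σ : SpinConfig V) :
    Tendsto (fun N : ℕ => ∑ n ∈ Fintype.piFinset (fun _ : G.edgeFinset => range N),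
        Current.weight β n * ∏ e : G.edgeFinset, bondSpin σ (e : Sym2 V) ^ n e) atTop
      (𝓝 (∏ e : G.edgeFinset, Real.exp (β * bondSpin σ (e : Sym2 V)))) := by
  simp_rw [Current.sum_piFinset_weight_mul G β (fun e : G.edgeFinset => bondSpin σ (e : Sym2 V))]
  refine tendsto_finsetProd _ fun e _ => ?_
  have h : HasSum (fun k : ℕ => (β * bondSpin σ (e : Sym2 V)) ^ k / (k.factorial : ℝ)) (Real.exp (β * bondSpin σ (e : Sym2 V))) := by
    rw [Real.exp_eq_exp_ℝ]
    exact NormedSpace.expSeries_div_hasSum_exp (β * bondSpin σ (e : Sym2 V))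
  exact h.tendsto_sum_nat

/-- **The numerators of the random-current representation** (Duminil-Copin 2016, §2.1, eq. (2.2)):
`∑_τ σ_A(τ) e^{-βH(τ)} = 2^{|V|} ∑_{∂n = A} w_β(n)` for the free-boundary, zero-field model on
the whole finite graph. [cite: DuminilCopin2016, §2.1, eq. (2.2)] -/
theorem sum_isingWeight_mul_spinProduct_eq (β : ℝ) (A : Finset V) :
    ∑ τ : ↥(univ : Finset V) → ℤˣ, isingWeight G univ β 0 .free τ * spinProduct A (glue univ τ .free) =
      (2 : ℝ) ^ Fintype.card V * currentSum G β A := by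
  classical
  -- pass to configurations on `V`
  set eqv : (↥(univ : Finset V) → ℤˣ) ≃ SpinConfig V :=
    (Equiv.subtypeUnivEquiv (fun x : V => Finset.mem_univ x)).arrowCongr (Equiv.refl ℤˣ) with heqv
  have hglue : ∀ τ : ↥(univ : Finset V) → ℤˣ, glue univ τ .free = eqv τ := by
    intro τ; funext x
    rw [glue_apply_of_mem _ _ _ (Finset.mem_univ x)]
    simp [heqv, Equiv.arrowCongr_apply, Equiv.subtypeUnivEquiv]
  have hL : ∑ τ : ↥(univ : Finset V) → ℤˣ, isingWeight G univ β 0 .free τ * spinProduct A (glue univ τ .free) =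
      ∑ σ : SpinConfig V, spinProduct A σ * ∏ e : G.edgeFinset, Real.exp (β * bondSpin σ (e : Sym2 V)) := by
    refine Fintype.sum_equiv eqv _ _ fun τ => ?_
    rw [isingWeight_univ_free_eq, hglue, mul_comm]
  rw [hL]
  -- both sides are limits of the same box partial sums
  have h1 : Tendsto (fun N : ℕ => ∑ σ : SpinConfig V, spinProduct A σ *
      ∑ n ∈ Fintype.piFinset (fun _ : G.edgeFinset => range N), Current.weight β n * ∏ e : G.edgeFinset, bondSpin σ (e : Sym2 V) ^ n e)
      atTop (𝓝 (∑ σ : SpinConfig V, spinProduct A σ * ∏ e : G.edgeFinset, Real.exp (β * bondSpin σ (e : Sym2 V)))) :=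
    tendsto_finsetSum _ fun σ _ => (tendsto_sum_piFinset_weight_mul_prod G β σ).const_mul _
  have h2 : Tendsto (fun N : ℕ => ∑ σ : SpinConfig V, spinProduct A σ *
      ∑ n ∈ Fintype.piFinset (fun _ : G.edgeFinset => range N), Current.weight β n * ∏ e : G.edgeFinset, bondSpin σ (e : Sym2 V) ^ n e)
      atTop (𝓝 ((2 : ℝ) ^ Fintype.card V * currentSum G β A)) := by
    have hre : ∀ N : ℕ, ∑ σ : SpinConfig V, spinProduct A σ *
        ∑ n ∈ Fintype.piFinset (fun _ : G.edgeFinset => range N), Current.weight β n * ∏ e : G.edgeFinset, bondSpin σ (e : Sym2 V) ^ n e =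
        (2 : ℝ) ^ Fintype.card V * ∑ n ∈ Fintype.piFinset (fun _ : G.edgeFinset => range N),
          (if Current.sources n = A then Current.weight β n else 0) := by
      intro N
      simp_rw [Finset.mul_sum]
      rw [Finset.sum_comm]
      refine Finset.sum_congr rfl fun n _ => ?_
      have h := sum_spinProduct_mul_prod_bondSpin_pow G A n
      calc ∑ σ : SpinConfig V, spinProduct A σ * (Current.weight β n * ∏ e : G.edgeFinset, bondSpin σ (e : Sym2 V) ^ n e)
          = Current.weight β n * ∑ σ : SpinConfig V, spinProduct A σ * ∏ e : G.edgeFinset, bondSpin σ (e : Sym2 V) ^ n e := by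
            rw [Finset.mul_sum]; exact Finset.sum_congr rfl fun σ _ => by ring
        _ = (2 : ℝ) ^ Fintype.card V * (if Current.sources n = A then Current.weight β n else 0) := by
            rw [h]; split_ifs <;> ring
    simp_rw [hre]
    exact (tendsto_sum_piFinset_of_summable G (summable_currentWeight_indicator_holds G β A)).const_mul _
  exact tendsto_nhds_unique h1 h2

/-- **Discharge of `isingPartitionFunction_free_eq`**: `Z^∅_{G;β,0} = 2^{|V|} ∑_{∂n=∅} w_β(n)`
(Griffiths–Hurst–Sherman 1970; Duminil-Copin 2016, §2.1). [cite: DuminilCopin2016, §2.1, eq. (2.2)] [cite: GriffithsHurstSherman1970] -/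
theorem isingPartitionFunction_free_eq_holds : isingPartitionFunction_free_eq G := by
  intro β
  have h := sum_isingWeight_mul_spinProduct_eq G β ∅
  have h1 : ∀ σ : SpinConfig V, spinProduct ∅ σ = 1 := fun σ => by simp [spinProduct]
  simp only [h1, mul_one] at h
  rw [isingPartitionFunction]
  exact h

/-- `∑_{∂n = ∅} w_β(n) = 2^{-|V|} Z^∅_{G;β,0} > 0` for every real `β`. [cite: DuminilCopin2016, §2.1, eq. (2.2)] -/
theorem currentSum_empty_pos' (β : ℝ) : 0 < currentSum G β ∅ := by
  have h := isingPartitionFunction_free_eq_holds G β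
  have hZ := isingPartitionFunction_pos G univ β 0 .free
  have h2 : 0 < (2 : ℝ) ^ Fintype.card V * currentSum G β ∅ := lt_of_lt_of_eq hZ h
  exact pos_of_mul_pos_right h2 (by positivity)

/-- **Discharge of `isingCorr_free_eq_currentSum_div`** — the random-current representation of
correlations, `⟨σ_A⟩^∅_{G;β,0} = ∑_{∂n=A} w_β(n) / ∑_{∂n=∅} w_β(n)` (Griffiths–Hurst–Sherman 1970;
Duminil-Copin 2016, §2.1, eq. (2.2)). [cite: DuminilCopin2016, §2.1, eq. (2.2)] [cite: GriffithsHurstSherman1970] -/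
theorem isingCorr_free_eq_currentSum_div_holds : isingCorr_free_eq_currentSum_div G := by
  intro β A
  calc isingCorr G univ β 0 .free A
      = (∑ τ : ↥(univ : Finset V) → ℤˣ, isingWeight G univ β 0 .free τ * spinProduct A (glue univ τ .free)) /
          isingPartitionFunction G univ β 0 .free :=
        integral_isingMeasure G univ β 0 .free (measurable_spinProduct A)
    _ = (2 : ℝ) ^ Fintype.card V * currentSum G β A / ((2 : ℝ) ^ Fintype.card V * currentSum G β ∅) := by
        rw [sum_isingWeight_mul_spinProduct_eq, isingPartitionFunction_free_eq_holds G β]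
    _ = currentSum G β A / currentSum G β ∅ := mul_div_mul_left _ _ (by positivity)

/-- **Discharge of `isingTwoPoint_free_eq_currentSum_div`**: `⟨σ_xσ_y⟩^∅_{G;β,0} =
∑_{∂n = {x}∆{y}} w_β(n) / ∑_{∂n=∅} w_β(n)` (also on the diagonal, where both sides are `1`). [cite: DuminilCopin2016, §2.1, eq. (2.2)] -/
theorem isingTwoPoint_free_eq_currentSum_div_holds : isingTwoPoint_free_eq_currentSum_div G := by
  intro β x y
  by_cases hxy : x = y
  · subst hxy
    rw [isingTwoPoint_self, symmDiff_self, Finset.bot_eq_empty, div_self (currentSum_empty_pos' G β).ne']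
  · have hsp : spinPair x y = spinProduct ({x} ∆ {y}) := by
      funext σ
      have hd : ({x} : Finset V) ∆ {y} = {x, y} := by
        ext w
        simp only [Finset.mem_symmDiff, Finset.mem_singleton, Finset.mem_insert]
        constructor
        · rintro (⟨h, _⟩ | ⟨h, _⟩)
          · exact Or.inl h
          · exact Or.inr h
        · rintro (rfl | rfl)
          · exact Or.inl ⟨rfl, hxy⟩
          · exact Or.inr ⟨rfl, fun h => hxy h.symm⟩
      rw [hd, spinPair, spinProduct, Finset.prod_pair hxy]
    calc isingTwoPoint G univ β 0 .free x y = isingCorr G univ β 0 .free ({x} ∆ {y}) := by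
          rw [isingTwoPoint, hsp]; rfl
      _ = _ := isingCorr_free_eq_currentSum_div_holds G β _

end CurrentSum

/-! ### Pairs of currents -/

section DoubleCurrent

variable [DecidableEq V]

/-- The pair weight is the product of the two indicator-restricted weights. [folklore] -/
theorem pairWeight_eq_mul (β : ℝ) (A B : Finset V) (p : Current G × Current G) :
    pairWeight G β A B p =
      (if p.1.sources = A then p.1.weight β else 0) * (if p.2.sources = B then p.2.weight β else 0) := by
  unfold pairWeight
  split_ifs with h h1 h2 h2 <;> simp_all

/-- **Discharge of `hasSum_pairWeight`**: the pair weights sum to `currentSum A · currentSum B`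
(product of two absolutely convergent series; Duminil-Copin 2016, §2.2). [cite: DuminilCopin2016, §2.2] -/
theorem hasSum_pairWeight_holds (β : ℝ) (A B : Finset V) :
    HasSum (pairWeight G β A B) (currentSum G β A * currentSum G β B) := by
  set f : Current G → ℝ := fun n => if n.sources = A then n.weight β else 0 with hf
  set g : Current G → ℝ := fun n => if n.sources = B then n.weight β else 0 with hg
  have hA : Summable f := summable_currentWeight_indicator_holds G β A
  have hB : Summable g := summable_currentWeight_indicator_holds G β B
  have hnA : Summable fun n : Current G => ‖f n‖ := hA.norm
  have hnB : Summable fun n : Current G => ‖g n‖ := hB.norm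
  have hprod : Summable fun p : Current G × Current G => f p.1 * g p.2 :=
    summable_mul_of_summable_norm (f := f) (g := g) hnA hnB
  have key : pairWeight G β A B = fun p : Current G × Current G => f p.1 * g p.2 :=
    funext (pairWeight_eq_mul G β A B)
  have h : HasSum (fun p : Current G × Current G => f p.1 * g p.2) ((∑' n, f n) * ∑' n, g n) :=
    hA.hasSum.mul hB.hasSum hprod
  rw [key, currentSum, currentSum]
  exact h

/-- **Discharge of `hasSum_pairWeight`** in the tree's spelling. [cite: DuminilCopin2016, §2.2] -/
theorem hasSum_pairWeight_holds' : hasSum_pairWeight G := fun β A B => hasSum_pairWeight_holds G β A B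

/-- **Discharge of `isProbabilityMeasure_doubleCurrentMeasure`**: for `β ≥ 0` and nondegenerate
normalisers the double-current measure has total mass
`∑_p w(p)/(Z_A Z_B) = (Z_A Z_B)/(Z_A Z_B) = 1` (Duminil-Copin 2016, §2.2). [cite: DuminilCopin2016, §2.2] -/
theorem isProbabilityMeasure_doubleCurrentMeasure_holds : isProbabilityMeasure_doubleCurrentMeasure G := by
  intro β hβ A B hA hB
  constructor
  rw [doubleCurrentMeasure, Measure.sum_apply _ MeasurableSet.univ]
  simp only [Measure.smul_apply, Measure.dirac_apply_of_mem (Set.mem_univ _), smul_eq_mul, mul_one]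
  have hnonneg : ∀ p : Current G × Current G, 0 ≤ pairWeight G β A B p / (currentSum G β A * currentSum G β B) :=
    fun p => div_nonneg (pairWeight_nonneg G hβ A B p)
      (mul_nonneg (currentSum_nonneg G hβ A) (currentSum_nonneg G hβ B))
  have hsum : HasSum (fun p : Current G × Current G => pairWeight G β A B p / (currentSum G β A * currentSum G β B)) 1 := by
    have h := (hasSum_pairWeight_holds G β A B).div_const (currentSum G β A * currentSum G β B)
    rwa [div_self (mul_ne_zero hA hB)] at h
  rw [← ENNReal.ofReal_one, ← hsum.tsum_eq, ENNReal.ofReal_tsum_of_nonneg hnonneg hsum.summable]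

end DoubleCurrent

end Literature.Probability.LatticeModels

/-! ## Part II: the switching lemma -/

namespace Literature.Probability.LatticeModels

variable {V : Type*} [Fintype V] (G : SimpleGraph V) [DecidableRel G.Adj] [DecidableEq V]

namespace Current

/-! ### Labelled sub-currents of a current `m`

A current `n ≤ m` together with a choice, for every edge `e`, of *which* `n_e` of the `m_e`
parallel copies of `e` are used, is a family `T e ⊆ Fin (m e)` ("subgraphs `𝓝` of the multigraph
`𝓜`", Duminil-Copin 2016, proof of Lemma 2.2); there are `∏_e C(m_e, n_e)` of them over each
`n ≤ m`. -/

/-- **Counting labelled sub-currents**: summing a function of the underlying current over all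
labelled sub-currents of `m` produces the binomial weights `∏_e C(m_e, n_e)` ("`C(𝓜, 𝓝)` can be
interpreted as the number of subgraphs of `𝓜` with exactly `n_{xy}` edges between `x` and `y`",
Duminil-Copin 2016, proof of Lemma 2.2). [cite: DuminilCopin2016, Lemma 2.2 (proof)] -/
theorem sum_labelled_eq_sum_binom (m : Current G) (c : Current G → ℝ) :
    ∑ T : (e : G.edgeFinset) → Finset (Fin (m e)), c (fun e => (T e).card) =
      ∑ n ∈ Fintype.piFinset (fun e : G.edgeFinset => range (m e + 1)),
        c n * ∏ e, ((m e).choose (n e) : ℝ) := by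
  classical
  set box := Fintype.piFinset (fun e : G.edgeFinset => range (m e + 1)) with hbox
  have hmaps : ∀ T ∈ (univ : Finset ((e : G.edgeFinset) → Finset (Fin (m e)))),
      (fun e => (T e).card) ∈ box := by
    intro T _
    rw [hbox, Fintype.mem_piFinset]
    intro e
    rw [mem_range, Nat.lt_succ_iff]
    exact (Finset.card_le_univ (T e)).trans (by simp)
  rw [← Finset.sum_fiberwise_of_maps_to hmaps]
  refine Finset.sum_congr rfl fun n hn => ?_
  have hfib : (univ : Finset ((e : G.edgeFinset) → Finset (Fin (m e)))).filter
      (fun T => (fun e => (T e).card) = n) =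
      Fintype.piFinset fun e : G.edgeFinset => Finset.powersetCard (n e) univ := by
    ext T
    simp only [Finset.mem_filter, Finset.mem_univ, true_and, Fintype.mem_piFinset,
      Finset.mem_powersetCard, Finset.subset_univ, funext_iff]
  rw [Finset.sum_congr rfl fun T hT => by rw [(Finset.mem_filter.1 hT).2], Finset.sum_const, hfib,
    Fintype.card_piFinset, nsmul_eq_mul, mul_comm]
  congr 1
  rw [Nat.cast_prod]
  refine Finset.prod_congr rfl fun e _ => ?_
  rw [Finset.card_powersetCard, Finset.card_univ, Fintype.card_fin]

/-! ### Parities: sources of labelled sub-currents and symmetric differences -/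

/-- `#(S ∆ S') + 2 #(S ∩ S') = #S + #S'`. [folklore] -/
theorem card_symmDiff_add {α : Type*} [DecidableEq α] (S S' : Finset α) :
    (S ∆ S').card + 2 * (S ∩ S').card = S.card + S'.card := by
  rw [symmDiff_def, Finset.sup_eq_union, Finset.card_union_of_disjoint disjoint_sdiff_sdiff]
  have h1 := Finset.card_sdiff_add_card_inter S S'
  have h2 := Finset.card_sdiff_add_card_inter S' S
  rw [Finset.inter_comm S' S] at h2
  omega

/-- The degree of a vertex in a labelled sub-current is additive modulo `2` under symmetric
differences of the labels. [folklore] -/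
theorem degree_symmDiff_mod_two {m : Current G} (T K : (e : G.edgeFinset) → Finset (Fin (m e))) (v : V) :
    (degree (fun e => ((T e) ∆ (K e)).card) v) % 2 =
      (degree (fun e => (T e).card) v + degree (fun e => (K e).card) v) % 2 := by
  simp only [degree, ← Finset.sum_add_distrib]
  rw [Finset.sum_nat_mod, Finset.sum_nat_mod (Finset.univ) 2 (fun e => _ + _)]
  congr 1
  refine Finset.sum_congr rfl fun e _ => ?_
  split_ifs
  · have h := card_symmDiff_add (T e) (K e)
    omega
  · rfl

/-- **Sources are additive under symmetric differences of the labels**: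
`∂(T ∆ K) = ∂T ∆ ∂K` (the mechanism of the involution `𝓝 ↦ 𝓝 ∆ 𝓚` in the proof of the
switching lemma, Duminil-Copin 2016, Lemma 2.2). [cite: DuminilCopin2016, Lemma 2.2 (proof)] -/
theorem sources_symmDiff {m : Current G} (T K : (e : G.edgeFinset) → Finset (Fin (m e))) :
    sources (fun e => ((T e) ∆ (K e)).card) = sources (fun e => (T e).card) ∆ sources (fun e => (K e).card) := by
  ext v
  simp only [mem_sources_iff, Finset.mem_symmDiff, Nat.odd_iff]
  rw [degree_symmDiff_mod_two G T K v, Nat.add_mod]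
  have h1 := Nat.mod_two_eq_zero_or_one (degree (fun e => (T e).card) v)
  have h2 := Nat.mod_two_eq_zero_or_one (degree (fun e => (K e).card) v)
  rcases h1 with h1 | h1 <;> rcases h2 with h2 | h2 <;> simp [h1, h2]

/-- The involution `T ↦ T ∆ K` of labelled sub-currents exchanges the source constraints `S` and
`S ∆ ∂K`, so the two classes are equinumerous (Duminil-Copin 2016, proof of Lemma 2.2: "The map
`𝓝 ↦ 𝓝 ∆ 𝓚` is a bijection (in fact an involution)"). [cite: DuminilCopin2016, Lemma 2.2 (proof)] -/
theorem card_filter_sources_eq_of_symmDiff {m : Current G} (K : (e : G.edgeFinset) → Finset (Fin (m e)))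
    (S : Finset V) :
    ((univ : Finset ((e : G.edgeFinset) → Finset (Fin (m e)))).filter
        (fun T => sources (fun e => (T e).card) = S)).card =
      ((univ : Finset ((e : G.edgeFinset) → Finset (Fin (m e)))).filter
        (fun T => sources (fun e => (T e).card) = S ∆ sources (fun e => (K e).card))).card := by
  refine Finset.card_bij (fun T _ => fun e => (T e) ∆ (K e)) (fun T hT => ?_) (fun T₁ _ T₂ _ h => ?_)
    (fun T hT => ?_)
  · rw [Finset.mem_filter] at hT ⊢
    refine ⟨Finset.mem_univ _, ?_⟩
    rw [sources_symmDiff, hT.2]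
  · funext e
    have h' := congrFun h e
    exact symmDiff_left_injective _ h'
  · refine ⟨fun e => (T e) ∆ (K e), ?_, ?_⟩
    · rw [Finset.mem_filter] at hT ⊢
      refine ⟨Finset.mem_univ _, ?_⟩
      rw [sources_symmDiff, hT.2, symmDiff_assoc, symmDiff_self, symmDiff_bot]
    · funext e
      simp only
      rw [symmDiff_assoc, symmDiff_self, symmDiff_bot]

/-! ### A path in the trace gives a labelled sub-current with two sources -/

omit [DecidableEq V] in
/-- The edges of a walk in the traced graph of `m` carry positive current. [folklore] -/
theorem pos_of_mem_edges_traced {m : Current G} {x y : V} (p : (Percolation.openGraph m.traced).Walk x y)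
    (e : G.edgeFinset) (he : (e : Sym2 V) ∈ p.edges) : 0 < m e := by
  have h1 := p.edges_subset_edgeSet he
  rw [Percolation.openGraph, SimpleGraph.edgeSet_fromEdgeSet] at h1
  obtain ⟨⟨he', hlt⟩, _⟩ := h1
  exact hlt

omit [DecidableEq V] in
/-- The edges of a walk in the traced graph of `m` are edges of `G`. [folklore] -/
theorem mem_edgeFinset_of_mem_edges_traced {m : Current G} {x y : V} (p : (Percolation.openGraph m.traced).Walk x y)
    {e : Sym2 V} (he : e ∈ p.edges) : e ∈ G.edgeFinset := by
  have h1 := p.edges_subset_edgeSet he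
  rw [Percolation.openGraph, SimpleGraph.edgeSet_fromEdgeSet] at h1
  obtain ⟨⟨he', _⟩, _⟩ := h1
  exact he'

/-- **The sub-current `𝓚`** (Duminil-Copin 2016, proof of Lemma 2.2): if `x ≠ y` are connected in the
trace of `m`, one copy of each edge of a simple path from `x` to `y` forms a labelled sub-current
of `m` with sources exactly `{x, y}` (a vertex meets an odd number of edges of a path iff it is an
endpoint, `SimpleGraph.Walk.IsTrail.even_countP_edges_iff`). [cite: DuminilCopin2016, Lemma 2.2 (proof)] -/
theorem exists_labelled_sources_pair {m : Current G} {x y : V} (hxy : x ≠ y)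
    (h : (Percolation.openGraph m.traced).Reachable x y) :
    ∃ K : (e : G.edgeFinset) → Finset (Fin (m e)), sources (fun e => (K e).card) = {x, y} := by
  classical
  obtain ⟨p, hp⟩ : ∃ p : (Percolation.openGraph m.traced).Walk x y, p.IsPath := h.elim_path fun q => ⟨q.1, q.2⟩
  refine ⟨fun e => if he : (e : Sym2 V) ∈ p.edges then {⟨0, pos_of_mem_edges_traced G p e he⟩} else ∅, ?_⟩
  have hnodup : p.edges.Nodup := hp.isTrail.edges_nodup
  ext v
  rw [mem_sources_iff, Finset.mem_insert, Finset.mem_singleton]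
  -- the degree of `v` is the number of edges of `p` containing `v`
  have hdeg : degree (fun e : G.edgeFinset => (if he : (e : Sym2 V) ∈ p.edges then
      ({⟨0, pos_of_mem_edges_traced G p e he⟩} : Finset (Fin (m e))) else ∅).card) v =
      ((p.edges.toFinset).filter fun e => v ∈ e).card := by
    simp only [degree]
    have h1 : ∀ e : G.edgeFinset, (if v ∈ (e : Sym2 V) then (if he : (e : Sym2 V) ∈ p.edges then
        ({⟨0, pos_of_mem_edges_traced G p e he⟩} : Finset (Fin (m e))) else ∅).card else 0) =
        if v ∈ (e : Sym2 V) ∧ (e : Sym2 V) ∈ p.edges then 1 else 0 := by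
      intro e
      by_cases hv : v ∈ (e : Sym2 V) <;> by_cases he : (e : Sym2 V) ∈ p.edges <;> simp [hv, he]
    rw [Finset.sum_congr rfl fun e _ => h1 e, Finset.sum_boole, Nat.cast_id]
    refine Finset.card_bij (fun e _ => (e : Sym2 V)) (fun e he => ?_) (fun e₁ _ e₂ _ h => Subtype.ext h)
      (fun z hz => ?_)
    · rw [Finset.mem_filter] at he ⊢
      exact ⟨List.mem_toFinset.2 he.2.2, he.2.1⟩
    · rw [Finset.mem_filter, List.mem_toFinset] at hz
      exact ⟨⟨z, mem_edgeFinset_of_mem_edges_traced G p hz.1⟩, by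
        rw [Finset.mem_filter]; exact ⟨Finset.mem_univ _, hz.2, hz.1⟩, rfl⟩
  have hcount : ((p.edges.toFinset).filter fun e => v ∈ e).card = p.edges.countP fun e => v ∈ e := by
    have hset : (p.edges.toFinset).filter (fun e => v ∈ e) = (p.edges.filter fun e => decide (v ∈ e)).toFinset := by
      ext z
      simp
    rw [hset, List.toFinset_card_of_nodup (hnodup.filter _), List.countP_eq_length_filter]
  rw [hdeg, hcount, ← Nat.not_even_iff_odd, hp.isTrail.even_countP_edges_iff v]
  constructor
  · intro hne
    by_contra hv
    exact hne fun _ => ⟨fun h1 => hv (Or.inl h1), fun h2 => hv (Or.inr h2)⟩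
  · rintro (rfl | rfl) himp
    · exact (himp hxy).1 rfl
    · exact (himp hxy).2 rfl

/-! ### The handshake lemma: a source is connected to another source -/

/-- In the trace of a current, every source is connected to some other source (the sum of the
degrees over a connected component is even; the fact "any current with sources `{x,y}` connects
`x` to `y`" used throughout Duminil-Copin 2016, §2). [cite: DuminilCopin2016, §2.2] -/
theorem exists_source_reachable (k : Current G) {x : V} (hx : x ∈ sources k) :
    ∃ y ∈ sources k, y ≠ x ∧ (Percolation.openGraph k.traced).Reachable x y := by
  classical
  obtain ⟨C, hC⟩ : ∃ C : Finset V, ∀ v, v ∈ C ↔ (Percolation.openGraph k.traced).Reachable x v :=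
    ⟨(univ : Finset V).filter (fun v => (Percolation.openGraph k.traced).Reachable x v), fun v => by simp⟩
  have hxC : x ∈ C := (hC x).2 (SimpleGraph.Reachable.refl x)
  -- the degree sum over `C` is even
  have hswap : ∑ v ∈ C, k.degree v = ∑ e : G.edgeFinset, k e * (C.filter fun v => v ∈ (e : Sym2 V)).card := by
    simp only [degree]
    rw [Finset.sum_comm]
    refine Finset.sum_congr rfl fun e _ => ?_
    rw [← Finset.sum_filter, Finset.sum_const, smul_eq_mul, mul_comm]
  have hterm : ∀ e : G.edgeFinset, Even (k e * (C.filter fun v => v ∈ (e : Sym2 V)).card) := by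
    intro e
    rcases Nat.eq_zero_or_pos (k e) with h0 | hpos
    · rw [h0, zero_mul]; exact ⟨0, rfl⟩
    · obtain ⟨e, he⟩ := e
      revert he hpos
      induction e using Sym2.ind with
      | _ a b =>
        intro he hpos
        have hab : a ≠ b := G.ne_of_adj (SimpleGraph.mem_edgeFinset.1 he)
        have hadj : (Percolation.openGraph k.traced).Adj a b := by
          rw [Percolation.openGraph_adj]
          exact ⟨⟨he, hpos⟩, hab⟩
        have hiff : a ∈ C ↔ b ∈ C := by
          rw [hC a, hC b]
          exact ⟨fun h => h.trans hadj.reachable, fun h => h.trans hadj.symm.reachable⟩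
        by_cases ha : a ∈ C
        · have hb : b ∈ C := hiff.1 ha
          have hset : C.filter (fun v => v ∈ (s(a, b) : Sym2 V)) = {a, b} := by
            ext v
            simp only [Finset.mem_filter, Sym2.mem_iff, Finset.mem_insert, Finset.mem_singleton]
            constructor
            · exact fun h => h.2
            · rintro (rfl | rfl)
              exacts [⟨ha, Or.inl rfl⟩, ⟨hb, Or.inr rfl⟩]
          refine ⟨k ⟨s(a, b), he⟩, ?_⟩
          simp only [hset, Finset.card_pair hab]
          ring
        · have hb : b ∉ C := fun hb => ha (hiff.2 hb)
          have hset : C.filter (fun v => v ∈ (s(a, b) : Sym2 V)) = ∅ := by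
            ext v
            simp only [Finset.mem_filter, Sym2.mem_iff, Finset.notMem_empty, iff_false, not_and]
            rintro hv (rfl | rfl)
            exacts [ha hv, hb hv]
          simp only [hset, Finset.card_empty, mul_zero]
          exact ⟨0, rfl⟩
  have heven : Even (∑ v ∈ C, k.degree v) := by
    rw [hswap]
    exact Finset.even_sum _ fun e _ => hterm e
  -- hence the number of odd-degree vertices of `C` is even
  have hpar : (∑ v ∈ C, k.degree v) % 2 = (C.filter fun v => Odd (k.degree v)).card % 2 := by
    have h1 : (C.filter fun v => Odd (k.degree v)).card = ∑ v ∈ C, k.degree v % 2 := by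
      rw [Finset.card_eq_sum_ones, Finset.sum_filter]
      refine Finset.sum_congr rfl fun v _ => ?_
      rcases Nat.even_or_odd (k.degree v) with h | h
      · rw [Nat.even_iff.1 h, if_neg (Nat.not_odd_iff_even.2 h)]
      · rw [Nat.odd_iff.1 h, if_pos h]
    rw [h1, Finset.sum_nat_mod]
  have hcard : Even ((C.filter fun v => Odd (k.degree v)).card) := by
    rw [Nat.even_iff, ← hpar, ← Nat.even_iff]; exact heven
  have hxO : x ∈ C.filter fun v => Odd (k.degree v) :=
    Finset.mem_filter.2 ⟨hxC, (mem_sources_iff k x).1 hx⟩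
  have hlt : 1 < (C.filter fun v => Odd (k.degree v)).card := by
    have h1 : 1 ≤ (C.filter fun v => Odd (k.degree v)).card := Finset.card_pos.2 ⟨x, hxO⟩
    rcases hcard with ⟨r, hr⟩
    omega
  obtain ⟨y, hy, hyx⟩ := Finset.exists_mem_ne hlt x
  rw [Finset.mem_filter] at hy
  exact ⟨y, (mem_sources_iff k y).2 hy.2, hyx, (hC y).1 hy.1⟩

/-! ### Sub-currents `n ≤ m`: boxes, sources of differences, binomial weights -/

/-- The box `{n | n ≤ m}` of sub-currents of `m`, as a `piFinset`. [folklore] -/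
theorem mem_box_iff {m n : Current G} :
    n ∈ Fintype.piFinset (fun e : G.edgeFinset => range (m e + 1)) ↔ n ≤ m := by
  simp only [Fintype.mem_piFinset, mem_range, Nat.lt_succ_iff]
  exact Iff.rfl

/-- The degree of a difference of currents: `deg_{m-n} = deg_m - deg_n` for `n ≤ m`. [folklore] -/
theorem degree_tsub {m n : Current G} (h : n ≤ m) (v : V) : (m - n).degree v = m.degree v - n.degree v := by
  simp only [degree, Pi.sub_apply]
  rw [← Finset.sum_tsub_distrib]
  · refine Finset.sum_congr rfl fun e _ => ?_
    split_ifs <;> simp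
  · intro e _
    split_ifs
    · exact h e
    · exact le_rfl

/-- `deg_n ≤ deg_m` for `n ≤ m`. [folklore] -/
theorem degree_mono {m n : Current G} (h : n ≤ m) (v : V) : n.degree v ≤ m.degree v := by
  simp only [degree]
  exact Finset.sum_le_sum fun e _ => by split_ifs <;> [exact h e; exact le_rfl]

/-- **Sources of a difference**: `∂(m - n) = ∂m ∆ ∂n` for `n ≤ m` (as for sums,
`Current.sources_add`). [cite: DuminilCopin2016, §2.2] -/
theorem sources_tsub {m n : Current G} (h : n ≤ m) : sources (m - n) = sources m ∆ sources n := by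
  ext v
  simp only [mem_sources_iff, Finset.mem_symmDiff, degree_tsub G h v, Nat.odd_sub (degree_mono G h v)]
  rw [← Nat.not_odd_iff_even]
  tauto

omit [DecidableEq V] in
/-- The trace of a difference is contained in the trace: `(m - n)^ ⊆ m̂`. [folklore] -/
theorem traced_tsub_subset {m n : Current G} : (m - n).traced ⊆ m.traced := by
  rintro e ⟨he, hpos⟩
  refine ⟨he, Nat.pos_of_ne_zero fun h0 => ?_⟩
  simp only [Pi.sub_apply, h0, Nat.zero_sub] at hpos
  exact lt_irrefl 0 hpos

omit [DecidableEq V] in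
/-- `n + (m - n) = m` for `n ≤ m`. [folklore] -/
theorem add_tsub_cancel {m n : Current G} (h : n ≤ m) : n + (m - n) = m := by
  funext e
  simp only [Pi.add_apply, Pi.sub_apply]
  have hle : n e ≤ m e := h e
  omega

omit [DecidableEq V] in
/-- **The binomial identity of the weights** (Duminil-Copin 2016, proof of Lemma 2.2, the display
"`w_β(𝐧) w_β(𝐦 - 𝐧) = w_β(𝐦) C(𝐦, 𝐧)`", `C(𝐦,𝐧) = ∏_{xy} C(m_{xy}, n_{xy})`). [cite: DuminilCopin2016, Lemma 2.2 (proof)] -/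
theorem weight_mul_weight_tsub {m n : Current G} (h : n ≤ m) (β : ℝ) :
    n.weight β * (m - n).weight β = m.weight β * ∏ e, ((m e).choose (n e) : ℝ) := by
  simp only [weight, ← Finset.prod_mul_distrib]
  refine Finset.prod_congr rfl fun e _ => ?_
  have hle : n e ≤ m e := h e
  simp only [Pi.sub_apply]
  have hfact : ((m e).choose (n e) : ℝ) * (n e).factorial * (m e - n e).factorial = (m e).factorial := by
    exact_mod_cast Nat.choose_mul_factorial_mul_factorial hle
  have h1 : ((n e).factorial : ℝ) ≠ 0 := by positivity
  have h2 : ((m e - n e).factorial : ℝ) ≠ 0 := by positivity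
  have h3 : ((m e).factorial : ℝ) ≠ 0 := by positivity
  have hpow : β ^ n e * β ^ (m e - n e) = β ^ m e := by rw [← pow_add, Nat.add_sub_cancel' hle]
  have hC : ((m e).choose (n e) : ℝ) ≠ 0 := by exact_mod_cast (Nat.choose_pos hle).ne'
  rw [div_mul_div_comm, hpow, ← hfact]
  field_simp

omit [Fintype V] [DecidableRel G.Adj] in
/-- `{x} ∆ {y} = {x, y}` for `x ≠ y`. [folklore] -/
theorem symmDiff_singleton_eq_pair {x y : V} (hxy : x ≠ y) : ({x} : Finset V) ∆ {y} = {x, y} := by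
  ext w
  simp only [Finset.mem_symmDiff, Finset.mem_singleton, Finset.mem_insert]
  constructor
  · rintro (⟨h, _⟩ | ⟨h, _⟩)
    · exact Or.inl h
    · exact Or.inr h
  · rintro (rfl | rfl)
    · exact Or.inl ⟨rfl, hxy⟩
    · exact Or.inr ⟨rfl, fun h => hxy h.symm⟩

/-- Counting sub-currents of `m` with prescribed sources, with binomial multiplicities, as the
number of labelled sub-currents with those sources. [cite: DuminilCopin2016, Lemma 2.2 (proof)] -/
theorem sum_box_ite_sources_eq_card (m : Current G) (S : Finset V) :
    ∑ n ∈ Fintype.piFinset (fun e : G.edgeFinset => range (m e + 1)),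
        (if sources n = S then ∏ e, ((m e).choose (n e) : ℝ) else 0) =
      (((univ : Finset ((e : G.edgeFinset) → Finset (Fin (m e)))).filter
        (fun T => sources (fun e => (T e).card) = S)).card : ℝ) := by
  have h := sum_labelled_eq_sum_binom G m (fun n => if sources n = S then 1 else 0)
  simp only [ite_mul, one_mul, zero_mul] at h
  rw [← h, Finset.card_eq_sum_ones, Nat.cast_sum, Finset.sum_filter]
  refine Finset.sum_congr rfl fun T _ => ?_
  split_ifs <;> simp

open Classical in
/-- **The combinatorial switching identity** (Duminil-Copin 2016, proof of Lemma 2.2): for a current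
`𝐦`, a set `A` and `x ≠ y`,
`∑_{𝐧 ≤ 𝐦, ∂𝐧 = A, ∂(𝐦-𝐧) = {x,y}} C(𝐦,𝐧) = 1{x ↔ y in 𝐦̂} ∑_{𝐧 ≤ 𝐦, ∂𝐧 = A ∆ {x,y}, ∂(𝐦-𝐧) = ∅} C(𝐦,𝐧)`
(if `x ↔ y` in `𝐦̂`, the involution `𝓝 ↦ 𝓝 ∆ 𝓚` with `∂𝓚 = {x,y}` on labelled sub-currents; if not,
the left side vanishes since any current with sources `{x,y}` connects `x` to `y`). [cite: DuminilCopin2016, Lemma 2.2 (proof)] -/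
theorem switching_comb (m : Current G) (A : Finset V) {x y : V} (hxy : x ≠ y) :
    ∑ n ∈ Fintype.piFinset (fun e : G.edgeFinset => range (m e + 1)),
        (if sources n = A ∧ sources (m - n) = {x} ∆ {y} then ∏ e, ((m e).choose (n e) : ℝ) else 0) =
      (if (Percolation.openGraph m.traced).Reachable x y then 1 else 0) *
        ∑ n ∈ Fintype.piFinset (fun e : G.edgeFinset => range (m e + 1)),
          (if sources n = A ∆ ({x} ∆ {y}) ∧ sources (m - n) = ∅ then ∏ e, ((m e).choose (n e) : ℝ) else 0) := by
  set B : Finset V := {x} ∆ {y} with hB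
  set box := Fintype.piFinset (fun e : G.edgeFinset => range (m e + 1)) with hbox
  by_cases hm : sources m = A ∆ B
  · -- the source constraints on `m - n` are automatic
    have hL : ∀ n ∈ box, (sources n = A ∧ sources (m - n) = B ↔ sources n = A) := by
      intro n hn
      refine ⟨fun h => h.1, fun h => ⟨h, ?_⟩⟩
      rw [sources_tsub G ((mem_box_iff G).1 hn), hm, h, symmDiff_comm A B, symmDiff_assoc, symmDiff_self,
        symmDiff_bot]
    have hR : ∀ n ∈ box, (sources n = A ∆ B ∧ sources (m - n) = ∅ ↔ sources n = A ∆ B) := by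
      intro n hn
      refine ⟨fun h => h.1, fun h => ⟨h, ?_⟩⟩
      rw [sources_tsub G ((mem_box_iff G).1 hn), hm, h, symmDiff_self, Finset.bot_eq_empty]
    rw [Finset.sum_congr rfl fun n hn => if_congr (hL n hn) rfl rfl,
      Finset.sum_congr rfl fun n hn => if_congr (hR n hn) rfl rfl,
      sum_box_ite_sources_eq_card, sum_box_ite_sources_eq_card]
    by_cases hr : (Percolation.openGraph m.traced).Reachable x y
    · rw [if_pos hr, one_mul]
      obtain ⟨K, hK⟩ := exists_labelled_sources_pair G hxy hr
      rw [card_filter_sources_eq_of_symmDiff G K A, hK, ← symmDiff_singleton_eq_pair hxy]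
    · rw [if_neg hr, zero_mul]
      -- no labelled sub-current has sources `A`: otherwise `m - n` would connect `x` to `y`
      rw [Nat.cast_eq_zero, Finset.card_eq_zero, Finset.filter_eq_empty_iff]
      intro T _ hT
      apply hr
      set n : Current G := fun e => (T e).card with hn
      have hnle : n ≤ m := fun e => (Finset.card_le_univ (T e)).trans (by simp)
      have hmn : sources (m - n) = B := by
        rw [sources_tsub G hnle, hm, hT, symmDiff_comm A B, symmDiff_assoc, symmDiff_self, symmDiff_bot]
      have hxk : x ∈ sources (m - n) := by
        rw [hmn, hB, symmDiff_singleton_eq_pair hxy]; exact Finset.mem_insert_self x {y}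
      obtain ⟨y', hy', hy'x, hreach⟩ := exists_source_reachable G (m - n) hxk
      rw [hmn, hB, symmDiff_singleton_eq_pair hxy, Finset.mem_insert, Finset.mem_singleton] at hy'
      rcases hy' with rfl | rfl
      · exact absurd rfl hy'x
      · exact hreach.mono (SimpleGraph.fromEdgeSet_mono (traced_tsub_subset G))
  · -- `∂m ≠ A ∆ B`: every summand vanishes on both sides
    have hL0 : ∀ n ∈ box, ¬(sources n = A ∧ sources (m - n) = B) := by
      rintro n hn ⟨h1, h2⟩
      apply hm
      rw [sources_tsub G ((mem_box_iff G).1 hn), h1] at h2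
      rw [← h2, symmDiff_comm _ A, ← symmDiff_assoc, symmDiff_self, bot_symmDiff]
    have hR0 : ∀ n ∈ box, ¬(sources n = A ∆ B ∧ sources (m - n) = ∅) := by
      rintro n hn ⟨h1, h2⟩
      apply hm
      rw [sources_tsub G ((mem_box_iff G).1 hn), h1, ← Finset.bot_eq_empty, symmDiff_eq_bot] at h2
      exact h2
    rw [Finset.sum_eq_zero fun n hn => if_neg (hL0 n hn), Finset.sum_eq_zero fun n hn => if_neg (hR0 n hn),
      mul_zero]

end Current

/-! ### The switching lemma -/

section Switching

open Current Filter Topology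

/-- Summability of `pairWeight · Φ` for bounded `Φ` (the pair weights are dominated by
`|w(n₁)||w(n₂)|`, a product of two absolutely convergent series). [cite: DuminilCopin2016, §2.2] -/
theorem summable_pairWeight_mul (β : ℝ) (S S' : Finset V) {Φ : Current G × Current G → ℝ} {C : ℝ}
    (hΦ : ∀ p, ‖Φ p‖ ≤ C) : Summable fun p : Current G × Current G => pairWeight G β S S' p * Φ p := by
  have hw := Current.summable_weight_abs G β
  have hprod : Summable fun p : Current G × Current G => Current.weight |β| p.1 * Current.weight |β| p.2 :=
    summable_mul_of_summable_norm (f := fun n : Current G => Current.weight |β| n)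
      (g := fun n : Current G => Current.weight |β| n)
      (hw.norm.congr fun n => by simp) (hw.norm.congr fun n => by simp)
  have hC : 0 ≤ C := le_trans (norm_nonneg _) (hΦ (0, 0))
  refine (hprod.mul_right C).of_norm_bounded fun p => ?_
  rw [norm_mul]
  refine mul_le_mul ?_ (hΦ p) (norm_nonneg _) (mul_nonneg (Current.weight_nonneg (abs_nonneg β) _)
    (Current.weight_nonneg (abs_nonneg β) _))
  rw [Real.norm_eq_abs]
  unfold pairWeight
  split_ifs
  · rw [abs_mul, Current.abs_weight, Current.abs_weight]
  · rw [abs_zero]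
    exact mul_nonneg (Current.weight_nonneg (abs_nonneg β) _) (Current.weight_nonneg (abs_nonneg β) _)

open Classical in
/-- **Reindexing pairs of currents by their sum**: for a summable `Φ`,
`∑_{(n₁,n₂)} Φ(n₁,n₂) = ∑_𝐦 ∑_{𝐧 ≤ 𝐦} Φ(𝐧, 𝐦 - 𝐧)` ("the change of variables `𝐦 = 𝐧₁ + 𝐧₂`,
`𝐧 = 𝐧₁`", Duminil-Copin 2016, proof of Lemma 2.2; the map `(n₁,n₂) ↦ (n₁+n₂, n₁)` is injective
with image `{(𝐦,𝐧) | 𝐧 ≤ 𝐦}`, and the inner sums are finite). [cite: DuminilCopin2016, Lemma 2.2 (proof)] -/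
theorem tsum_pair_eq_tsum_sum_box {Φ : Current G × Current G → ℝ} (hΦ : Summable Φ) :
    ∑' p, Φ p = ∑' m : Current G, ∑ n ∈ Fintype.piFinset (fun e : G.edgeFinset => range (m e + 1)), Φ (n, m - n) := by
  set Ψ : Current G × Current G → Current G × Current G := fun p => (p.1 + p.2, p.1) with hΨ
  set f : Current G × Current G → ℝ := fun q => if q.2 ≤ q.1 then Φ (q.2, q.1 - q.2) else 0 with hf
  have hinj : Function.Injective Ψ := by
    intro p q h
    simp only [hΨ, Prod.mk.injEq] at h
    obtain ⟨h1, h2⟩ := h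
    have h3 : p.2 = q.2 := by
      funext e
      have h1e := congrFun h1 e
      have h2e := congrFun h2 e
      simp only [Pi.add_apply] at h1e
      omega
    exact Prod.ext h2 h3
  have hcomp : ∀ p, f (Ψ p) = Φ p := by
    intro p
    simp only [hf, hΨ]
    have hle : p.1 ≤ p.1 + p.2 := fun e => Nat.le_add_right _ _
    have hsub : p.1 + p.2 - p.1 = p.2 := funext fun e => by
      show p.1 e + p.2 e - p.1 e = p.2 e
      omega
    rw [if_pos hle, hsub]
  have hsupp : ∀ q, q ∉ Set.range Ψ → f q = 0 := by
    intro q hq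
    simp only [hf]
    rw [if_neg]
    intro hle
    exact hq ⟨(q.2, q.1 - q.2), by simp only [hΨ]; rw [Current.add_tsub_cancel G hle]⟩
  have hfsumm : Summable f := (hinj.summable_iff hsupp).1 (by simpa only [Function.comp_def, hcomp] using hΦ)
  calc ∑' p, Φ p = ∑' p, f (Ψ p) := by simp only [hcomp]
    _ = ∑' q, f q := hinj.tsum_eq fun q hq => by
        by_contra hnot
        exact hq (hsupp q hnot)
    _ = ∑' m, ∑' n, f (m, n) := hfsumm.tsum_prod' fun m => summable_of_ne_finset_zero (s :=
          Fintype.piFinset (fun e : G.edgeFinset => range (m e + 1))) fun n hn => by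
        simp only [hf]
        rw [if_neg ((Current.mem_box_iff G).not.1 hn)]
    _ = ∑' m, ∑ n ∈ Fintype.piFinset (fun e : G.edgeFinset => range (m e + 1)), Φ (n, m - n) := by
        refine tsum_congr fun m => ?_
        rw [tsum_eq_sum (s := Fintype.piFinset (fun e : G.edgeFinset => range (m e + 1))) fun n hn => by
          simp only [hf]; rw [if_neg ((Current.mem_box_iff G).not.1 hn)]]
        refine Finset.sum_congr rfl fun n hn => ?_
        simp only [hf]
        rw [if_pos ((Current.mem_box_iff G).1 hn)]

open Classical in
/-- **The switching lemma, two-source form — discharge of `currentSum_switching`**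
(Griffiths–Hurst–Sherman 1970; Aizenman 1982, Lemma 3.2; Duminil-Copin 2016, Lemma 2.2):
for every `A ⊆ V`, vertices `x, y`, bounded `F` and real `β`,
`∑_{∂𝐧₁=A, ∂𝐧₂={x}∆{y}} F(𝐧₁+𝐧₂) w(𝐧₁)w(𝐧₂) =
 ∑_{∂𝐧₁=A∆{x}∆{y}, ∂𝐧₂=∅} F(𝐧₁+𝐧₂) w(𝐧₁)w(𝐧₂) 1{x ↔ y in 𝐧₁+𝐧₂}`.
Proof as printed: change variables to `(𝐦 = 𝐧₁+𝐧₂, 𝐧 = 𝐧₁)` (`tsum_pair_eq_tsum_sum_box`), use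
`w(𝐧)w(𝐦-𝐧) = w(𝐦)C(𝐦,𝐧)` (`weight_mul_weight_tsub`), and for each `𝐦` the combinatorial identity
`switching_comb` (labelled sub-currents and the involution `𝓝 ↦ 𝓝 ∆ 𝓚`). [cite: DuminilCopin2016, Lemma 2.2] [cite: GriffithsHurstSherman1970] -/
theorem currentSum_switching_holds : currentSum_switching G := by
  intro β A x y F hF
  obtain ⟨C, hC⟩ := hF
  set B : Finset V := {x} ∆ {y} with hB
  by_cases hxy : x = y
  · -- degenerate case: `B = ∅`, the connection indicator is `1`
    subst hxy
    have hB0 : B = ∅ := by rw [hB, symmDiff_self, Finset.bot_eq_empty]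
    have hA : A ∆ (∅ : Finset V) = A := by simp
    refine tsum_congr fun p => ?_
    rw [hB0, hA, Set.indicator_of_mem (mem_tracedConn_self G x p), Pi.one_apply, mul_one]
  -- summability of both families
  have hsL : Summable fun p : Current G × Current G => pairWeight G β A B p * F (p.1 + p.2) :=
    summable_pairWeight_mul G β A B (Φ := fun p => F (p.1 + p.2)) fun p => hC _
  have hsR : Summable fun p : Current G × Current G =>
      pairWeight G β (A ∆ B) ∅ p * F (p.1 + p.2) * (tracedConn G x y).indicator 1 p := by
    have h := summable_pairWeight_mul G β (A ∆ B) ∅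
      (Φ := fun p => F (p.1 + p.2) * (tracedConn G x y).indicator 1 p) (C := C) fun p => by
        rw [norm_mul]
        refine le_trans (mul_le_of_le_one_right (norm_nonneg _) ?_) (hC _)
        rw [Set.indicator_apply]
        split_ifs <;> simp
    exact h.congr fun p => by ring
  rw [tsum_pair_eq_tsum_sum_box G hsL, tsum_pair_eq_tsum_sum_box G hsR]
  refine tsum_congr fun m => ?_
  -- evaluate both inner sums
  have hbox : ∀ n ∈ Fintype.piFinset (fun e : G.edgeFinset => range (m e + 1)), n ≤ m :=
    fun n hn => (Current.mem_box_iff G).1 hn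
  have hL : ∀ n ∈ Fintype.piFinset (fun e : G.edgeFinset => range (m e + 1)),
      pairWeight G β A B (n, m - n) * F (n + (m - n)) =
        F m * m.weight β * (if sources n = A ∧ sources (m - n) = B then ∏ e, ((m e).choose (n e) : ℝ) else 0) := by
    intro n hn
    rw [Current.add_tsub_cancel G (hbox n hn)]
    unfold pairWeight
    split_ifs <;> (try rw [Current.weight_mul_weight_tsub G (hbox n hn)]) <;> ring
  have hR : ∀ n ∈ Fintype.piFinset (fun e : G.edgeFinset => range (m e + 1)),
      pairWeight G β (A ∆ B) ∅ (n, m - n) * F (n + (m - n)) * (tracedConn G x y).indicator 1 (n, m - n) =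
        F m * m.weight β * ((if (Percolation.openGraph m.traced).Reachable x y then 1 else 0) *
          (if sources n = A ∆ B ∧ sources (m - n) = ∅ then ∏ e, ((m e).choose (n e) : ℝ) else 0)) := by
    intro n hn
    have hind : (tracedConn G x y).indicator (1 : Current G × Current G → ℝ) (n, m - n) =
        if (Percolation.openGraph m.traced).Reachable x y then 1 else 0 := by
      rw [Set.indicator_apply, mem_tracedConn_iff]
      simp only [Current.add_tsub_cancel G (hbox n hn), Pi.one_apply]
    rw [hind, Current.add_tsub_cancel G (hbox n hn)]
    unfold pairWeight
    split_ifs <;> (try rw [Current.weight_mul_weight_tsub G (hbox n hn)]) <;> ring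
  rw [Finset.sum_congr rfl hL, Finset.sum_congr rfl hR, ← Finset.mul_sum, ← Finset.mul_sum, ← Finset.mul_sum,
    Current.switching_comb G m A hxy]

/-! ### Corollaries: the probabilistic switching identity and `⟨σ_xσ_y⟩² = P^{∅,∅}[x ↔ y]` -/

/-- The double-current measure of an event, as a series: for `β ≥ 0`,
`P^{A,B}(E) · (Z_A Z_B) = ∑_p w_{A,B}(p) 1_E(p)` whenever `Z_A Z_B ≠ 0`. [cite: DuminilCopin2016, §2.2] -/
theorem doubleCurrentMeasure_real_mul (β : ℝ) (hβ : 0 ≤ β) (A B : Finset V) {E : Set (Current G × Current G)}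
    (hE : MeasurableSet E) (hZ : currentSum G β A * currentSum G β B ≠ 0) :
    (doubleCurrentMeasure G β A B).real E * (currentSum G β A * currentSum G β B) =
      ∑' p, pairWeight G β A B p * E.indicator 1 p := by
  classical
  have hZpos : 0 < currentSum G β A * currentSum G β B :=
    lt_of_le_of_ne (mul_nonneg (currentSum_nonneg G hβ A) (currentSum_nonneg G hβ B)) (Ne.symm hZ)
  have hnn : ∀ p, 0 ≤ pairWeight G β A B p * E.indicator 1 p / (currentSum G β A * currentSum G β B) := by
    intro p
    refine div_nonneg (mul_nonneg (pairWeight_nonneg G hβ A B p) ?_) hZpos.le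
    rw [Set.indicator_apply]; split_ifs <;> simp
  have hsumm : Summable fun p => pairWeight G β A B p * E.indicator 1 p / (currentSum G β A * currentSum G β B) := by
    have h := (summable_pairWeight_mul G β A B (Φ := fun p => E.indicator (1 : Current G × Current G → ℝ) p)
      (C := 1) fun p => by rw [Set.indicator_apply]; split_ifs <;> simp).div_const
      (currentSum G β A * currentSum G β B)
    exact h
  have hmeas : (doubleCurrentMeasure G β A B) E =
      ENNReal.ofReal (∑' p, pairWeight G β A B p * E.indicator 1 p / (currentSum G β A * currentSum G β B)) := by
    rw [doubleCurrentMeasure, Measure.sum_apply _ hE]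
    simp only [Measure.smul_apply, smul_eq_mul, Measure.dirac_apply' _ hE]
    rw [ENNReal.ofReal_tsum_of_nonneg hnn hsumm]
    refine tsum_congr fun p => ?_
    rw [Set.indicator_apply, Set.indicator_apply]
    split_ifs <;> simp
  rw [measureReal_def, hmeas, ENNReal.toReal_ofReal (tsum_nonneg hnn), ← tsum_mul_right]
  exact tsum_congr fun p => div_mul_cancel₀ _ hZ

/-- **Discharge of `currentSum_mul_currentSum_pair`** (the switching lemma with `F = 1`, in
probabilistic form; Aizenman 1982, §3; Duminil-Copin 2016, Lemma 2.2 and §2.3): for `β ≥ 0`,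
`Z_A Z_{{x}∆{y}} = Z_{A∆{x}∆{y}} Z_∅ · P^{A∆{x}∆{y},∅}[x ↔ y in 𝐧₁+𝐧₂]`. [cite: DuminilCopin2016, Lemma 2.2] [cite: Aizenman1982, §3] -/
theorem currentSum_mul_currentSum_pair_holds : currentSum_mul_currentSum_pair G := by
  classical
  intro β hβ A x y
  have hsw := currentSum_switching_holds G β A x y (fun _ => 1) ⟨1, fun n => by simp⟩
  simp only [mul_one] at hsw
  rw [(hasSum_pairWeight_holds G β A ({x} ∆ {y})).tsum_eq] at hsw
  rw [hsw]
  set S := A ∆ ({x} ∆ {y}) with hS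
  by_cases hZ : currentSum G β S * currentSum G β ∅ = 0
  · -- degenerate: no current with sources `S`; all pair weights vanish
    have hS0 : currentSum G β S = 0 := by
      rcases mul_eq_zero.1 hZ with h | h
      · exact h
      · exact absurd h (currentSum_empty_pos' G β).ne'
    have hw0 : ∀ n : Current G, (if n.sources = S then n.weight β else 0) = 0 := by
      have hs := summable_currentWeight_indicator_holds G β S
      have hnn : ∀ n : Current G, 0 ≤ (if n.sources = S then n.weight β else 0) := fun n => by
        split_ifs; exacts [Current.weight_nonneg hβ n, le_rfl]
      have h0 : HasSum (fun n : Current G => if n.sources = S then n.weight β else 0) (currentSum G β S) :=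
        hs.hasSum
      rw [hS0] at h0
      have h := (hasSum_zero_iff_of_nonneg hnn).1 h0
      exact fun n => congrFun h n
    have hpw : ∀ p : Current G × Current G, pairWeight G β S ∅ p = 0 := by
      intro p
      rw [pairWeight_eq_mul, hw0 p.1, zero_mul]
    rw [hZ, zero_mul]
    simp [hpw]
  · have h := doubleCurrentMeasure_real_mul G β hβ S ∅ (measurableSet_tracedConn G x y) hZ
    rw [← h]
    ring

/-- **Discharge of `isingTwoPoint_free_sq_eq`** (Aizenman 1982, Prop. 3.1; Duminil-Copin 2016,
Cor. 2.3): `⟨σ_xσ_y⟩^∅_{G;β,0}² = P^∅ ⊗ P^∅[x ↔ y in 𝐧₁+𝐧₂]` for `β ≥ 0`. [cite: DuminilCopin2016, Cor. 2.3] [cite: Aizenman1982, Prop. 3.1] -/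
theorem isingTwoPoint_free_sq_eq_holds : isingTwoPoint_free_sq_eq G := by
  intro β hβ x y
  have h2 := isingTwoPoint_free_eq_currentSum_div_holds G β x y
  have hsw := currentSum_mul_currentSum_pair_holds G hβ ({x} ∆ {y}) x y
  rw [symmDiff_self, Finset.bot_eq_empty] at hsw
  have hZ := currentSum_empty_pos' G β
  rw [h2, div_pow, sq, sq, hsw]
  field_simp

end Switching

end Literature.Probability.LatticeModels
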